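import Summits.BirchSwinnertonDyer.BirchSwinnertonDyer.Theorems.KatoDescentTamePotSupersingularJetchevIrreducibleCoreVertexBridges
import Summits.BirchSwinnertonDyer.BirchSwinnertonDyer.Theorems.KatoDescentTamePotSupersingularJetchevIrreducibleSwapLevelRaisingNamedPrint
import Summits.BirchSwinnertonDyer.BirchSwinnertonDyer.Theorems.Rank1ResidualJetSection6BridgeSwap
import HarnessLib

/-!
# Crux `JetchevIrreducibleReadingByName` (item 20165, shared K8-t′ / K9, cell `bsd-potss`): the node
# `Sig.S2DivisibilityIrredAddv` WITHOUT the reading S2′ — McCallum Prop. 5.2 replaced by LEVEL RAISING AT MINIMAL DEPTH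
# (Kolyvagin's prime-swap walk in the kernel, irreducible row); on the face `p ≠ 3` from NAMED PRINT + S3′-lt + H63I

Seat `bsd-potss-k8t-c4` g12 (prover), `--supports stmt-BirchSwinnertonDyer-20165`, helper; route-free. HONEST
FRAMING: helper theorems only; nothing is booked, no item closes, BSD is proved for no curve by any of this.

WHAT. k9-c4 g10's bridge `JetchevIrreducibleCoreVertex.divisibilityIrredAddv_of_prop52IrredP_of_coreVertexExistenceIrredPlt_of_thm63`
(p551527) derives 20165's node S2 (`Sig.S2DivisibilityIrredAddv`, body VERBATIM) from the PRIMED reading S2′ `h52I`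
(McCallum 1991 Prop. 5.2), the `s < m` form S3′-lt `hCVIlt`, `hRCF` and the H63 node `H63I`. Cell `bsd-jet` pv-2 g6
observed that the §6 bridge consumes Prop. 5.2 ONLY as «level raising at minimal depth» and re-issued the bridge on that
binder (`JET.derivedPoint_divisible_of_levelRaising_of_section6_min`, p549281, image-free). This file runs k9-c4's §2
over pv-2's bridge:
* `divisibilityIrredAddv_of_levelRaisingIrred_of_coreVertexExistenceIrredPlt_of_thm63` — S2 ⟸ {`hRaiseI`, `hCVIlt`,
  `hRCF`, `H63I`}, where `hRaiseI` is the CLOSED irreducible level-raising schema (pv-2's `hraise` under 20165's frame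
  binders; a candidate RE-CUT of the stub S2′, weaker than Prop. 5.2 and exactly what is used);
* `divisibilityIrredAddv_ne_three_of_prop47P2_of_poitouTate_of_GZ31g_of_coreVertexExistenceIrredPlt_of_thm63` — on
  the face `p ≠ 3` (all of K8-t′, `p ≥ 5`): S2 with the extra binder `p ≠ 3` ⟸ {`h47P2`, `hPT`, `hGZg`, `hCVIlt`,
  `hRCF`, `H63I`}, `hRaiseI` being DISCHARGED there by this seat's kernel walk
  (`JetchevIrreducibleSwap.levelRaising_of_prop47P2_of_poitouTate_of_GZ31g`). With k9-c4 g10's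
  `coreVertexExistenceIrredP_lt_of_prop47P2_of_poitouTate_of_GZ31g` (S3′-lt ⟸ the same three facts) and the H63 node
  ⟸ {h47P2, hPT, F1′}, the node S2 of crux 20165 rests on NAMED PRINT ONLY on the K8-t′ face; on the K9 face `p = 3`
  the one input outside print is McCallum Prop. 4.4 at the Kolyvagin prime `ℓ = 2` (excluded by the `ℓ ≠ 2` typing of
  `GrossLMS1991.prop37_2_frobeniusCongruence`).
References (locators only; no cited FACT is declared): [cite: Jetchev2008, Prop. 5.3 (p. 823), Thm. 5.2 (p. 821), proof of
Thm. 1.4 (pp. 824–825), Rem. 6.2] [cite: McCallumLMS1991, §5 Prop. 5.2 and proof (pp. 304–306), §4 Prop. 4.4]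
[cite: GrossLMS1991, Prop. 3.7 (2), §4 Lemma 4.3] [cite: GrossZagier1986, III (3.1)]. Design: theorems only; `K : Type`.
Axioms: `propext`, `Classical.choice`, `Quot.sound`.
-/

set_option autoImplicit false
-- the Theorems directory repeats the summit name (sibling precedent `KatoDescentPotSupersingularAssembly.lean`)
set_option linter.dupNamespace false

noncomputable section

open scoped Classical NumberField

open WeierstrassCurve IsDedekindDomain NumberField Literature.NumberTheory.EllipticCurves
  Literature.NumberTheory.EllipticCurves.ModularForms Literature.NumberTheory.EllipticCurves.Jetchev2008
  Literature.NumberTheory.EllipticCurves.Rank1Residual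
  Literature.NumberTheory.GaloisRepresentations Literature.NumberTheory.GaloisCohomology
  Literature.NumberTheory.GaloisRepresentations.DiscreteGaloisModule
  Summit.BirchSwinnertonDyer.Rank1Residual Summit.BirchSwinnertonDyer.Rank1Residual.X11b
  Summit.BirchSwinnertonDyer.Rank1Residual.JET
  Summit.BirchSwinnertonDyer.BirchSwinnertonDyer.Theorems.JetchevIrreducibleReadingDivisibility
  Summit.BirchSwinnertonDyer.BirchSwinnertonDyer.Theorems.JetchevIrreducibleReadingDivisibilityPrimed
  Summit.BirchSwinnertonDyer.BirchSwinnertonDyer.Theorems.JetchevIrreducibleCoreVertex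

namespace Summit.BirchSwinnertonDyer.BirchSwinnertonDyer.Theorems.JetchevIrreducibleSwap

/-- **S2 (`Sig.S2DivisibilityIrredAddv`, body VERBATIM) from the irreducible LEVEL-RAISING schema `hRaiseI`, S3′-lt `hCVIlt`,
`hRCF` and `H63I`** — k9-c4 g10's `divisibilityIrredAddv_of_prop52IrredP_of_coreVertexExistenceIrredPlt_of_thm63` with pv-2's
bridge `JET.derivedPoint_divisible_of_levelRaising_of_section6_min` in place of the `h52row` bridge (the reading S2′ is no
longer an input; `Core k c := m_∞ < k → IsGlobalCoreVertex …` as there). CONDITIONAL; nothing asserted.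
[cite: Jetchev2008, proof of Thm. 1.4 (p. 825), Prop. 5.3, Thm. 5.2] [cite: McCallumLMS1991, §5 Prop. 5.2 (p. 304)] -/
theorem divisibilityIrredAddv_of_levelRaisingIrred_of_coreVertexExistenceIrredPlt_of_thm63
    (hRaiseI : ∀ (W : WeierstrassCurve ℚ) [W.IsElliptic] [W.IsGloballyMinimal] [NeZero (W.conductorNorm ℤ)],
        ¬ W.HasCM →
        ∀ (K : Type) [Field K] [NumberField K], IsImaginaryQuadratic K →
        NumberField.discr K ≠ -3 → NumberField.discr K ≠ -4 →
        SatisfiesHeegnerHypothesis (W.conductorNorm ℤ) K →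
        ∀ (τ : K ≃ₐ[ℚ] K), τ ≠ 1 →
        ∀ (p : ℕ) [Fact p.Prime], p ≠ 2 → W.HasIrreducibleModPGaloisRep p → p ∣ W.conductorNorm ℤ →
        ∀ (Dt : ModularParametrizationData W (W.conductorNorm ℤ)) (β : ℤ) (ι : K →+* ℂ)
          [∀ j : ℕ, NumberField (ringClassField K ι j)],
        ∀ (u : ℕ),
          (∀ (c : ℕ), Squarefree c →
            (∀ q ∈ c.primeFactors, Zhang2014.IsKolyvaginPrime (W.conductorNorm ℤ) W K p q ∧
              1 + u ≤ Zhang2014.kolyvaginIndex W p q) →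
            ∀ dc : KolyvaginHeegnerData Dt β ι c,
            ∃ Q : (W.baseChange (ringClassField K ι c)).toAffine.Point,
              ((p ^ u : ℕ) : ℤ) • Q = dc.derivedPoint) →
          ∀ (n₀ : ℕ), Squarefree n₀ →
            (∀ q ∈ n₀.primeFactors, Zhang2014.IsKolyvaginPrime (W.conductorNorm ℤ) W K p q ∧
              1 + u ≤ Zhang2014.kolyvaginIndex W p q) →
            ∀ d₀ : KolyvaginHeegnerData Dt β ι n₀,
            (¬ ∃ Q : (W.baseChange (ringClassField K ι n₀)).toAffine.Point,
              ((p ^ (u + 1) : ℕ) : ℤ) • Q = d₀.derivedPoint) →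
            ∀ m' : ℕ, ∃ (n : ℕ) (d : KolyvaginHeegnerData Dt β ι n), Squarefree n ∧
              (∀ q ∈ n.primeFactors, Zhang2014.IsKolyvaginPrime (W.conductorNorm ℤ) W K p q ∧
                max m' (1 + u) ≤ Zhang2014.kolyvaginIndex W p q) ∧
              ¬ ∃ Q : (W.baseChange (ringClassField K ι n)).toAffine.Point,
                ((p ^ (u + 1) : ℕ) : ℤ) • Q = d.derivedPoint)
    (hCVIlt : ∀ (W : WeierstrassCurve ℚ) [W.IsElliptic] [W.IsGloballyMinimal] [NeZero (W.conductorNorm ℤ)],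
        ¬ W.HasCM →
        ∀ (K : Type) [Field K] [NumberField K], IsImaginaryQuadratic K →
        NumberField.discr K ≠ -3 → NumberField.discr K ≠ -4 →
        SatisfiesHeegnerHypothesis (W.conductorNorm ℤ) K →
        ∀ (τ : K ≃ₐ[ℚ] K), τ ≠ 1 →
        ∀ (p : ℕ) [Fact p.Prime], p ≠ 2 → W.HasIrreducibleModPGaloisRep p → (p : ℤ) ∣ W.conductorNorm ℤ →
        ∀ (Dt : ModularParametrizationData W (W.conductorNorm ℤ)) (β : ℤ) (ι : K →+* ℂ)
          [∀ k : ℕ, NumberField (ringClassField K ι k)]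
          (d₁ : KolyvaginHeegnerData Dt β ι 1), ¬ IsOfFinAddOrder d₁.derivedPoint →
        ∀ (m : ℕ), 1 ≤ m →
        ∀ (c : ℕ) (d : KolyvaginHeegnerData Dt β ι c), Squarefree c →
          (∀ ℓ ∈ c.primeFactors, Zhang2014.IsKolyvaginPrime (W.conductorNorm ℤ) W K p ℓ) →
        ∀ (s : ℕ), s < m → ¬ IsOfFinAddOrder d.derivedPoint →
          (∃ Q : (W.baseChange (ringClassField K ι c)).toAffine.Point,
            ((p ^ s : ℕ) : ℤ) • Q = d.derivedPoint) →
          (¬ ∃ Q : (W.baseChange (ringClassField K ι c)).toAffine.Point,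
            ((p ^ (s + 1) : ℕ) : ℤ) • Q = d.derivedPoint) →
          ((s + m : ℕ) : ℕ∞) ≤ Zhang2014.levelIndex W p c →
          ∃ (c' : ℕ) (d' : KolyvaginHeegnerData Dt β ι c'), Squarefree c' ∧
            (∀ ℓ ∈ c'.primeFactors, Zhang2014.IsKolyvaginPrime (W.conductorNorm ℤ) W K p ℓ ∧
              m + s ≤ Zhang2014.kolyvaginIndex W p ℓ) ∧
            Jetchev2008.IsGlobalCoreVertex W K ι τ p m c' ∧
            ¬ IsOfFinAddOrder d'.derivedPoint ∧
            ¬ ∃ Q : (W.baseChange (ringClassField K ι c')).toAffine.Point,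
              ((p ^ (s + 1) : ℕ) : ℤ) • Q = d'.derivedPoint)
    (hRCF : ∀ (K : Type) [Field K] [NumberField K] (ι : K →+* ℂ), IsImaginaryQuadratic K →
      ∀ k : ℕ, NumberField (ringClassField K ι k))
    (H63I : ∀ (W : WeierstrassCurve ℚ) [W.IsElliptic] [W.IsGloballyMinimal] [NeZero (W.conductorNorm ℤ)],
      ¬ W.HasCM → ∀ (K : Type) [Field K] [NumberField K], IsImaginaryQuadratic K →
      NumberField.discr K ≠ -3 → NumberField.discr K ≠ -4 →
      SatisfiesHeegnerHypothesis (W.conductorNorm ℤ) K →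
      ∀ (τ : K ≃ₐ[ℚ] K), τ ≠ 1 →
      ∀ (p : ℕ) [Fact p.Prime], p ≠ 2 → Rank1Residual.Addv W p → 0 ≤ padicValRat p W.j →
      W.HasIrreducibleModPGaloisRep p →
      ¬ p ∣ (W.baseChange ℚ_[p]).localTamagawaNumber ℤ_[p] →
      (∀ (q' : ℕ) [Fact q'.Prime], q' ∣ W.conductorNorm ℤ →
        p ∣ (W.baseChange ℚ_[q']).localTamagawaNumber ℤ_[q'] → ¬ q' ^ 2 ∣ W.conductorNorm ℤ) →
      ∀ (Dt : ModularParametrizationData W (W.conductorNorm ℤ)) (β : ℤ) (ι : K →+* ℂ)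
        [∀ k : ℕ, NumberField (ringClassField K ι k)]
        (d₁ : KolyvaginHeegnerData Dt β ι 1), ¬ IsOfFinAddOrder d₁.derivedPoint →
      ∀ (q : ℕ) [Fact q.Prime], q ∣ W.conductorNorm ℤ → ¬ q ^ 2 ∣ W.conductorNorm ℤ → q ≠ p →
      ∀ (mdiv m : {c : ℕ // Squarefree c ∧ ∀ ℓ ∈ c.primeFactors,
          Zhang2014.IsKolyvaginPrime (W.conductorNorm ℤ) W K p ℓ} → ℕ∞),
      (∀ c (u : ℕ), (u : ℕ∞) ≤ mdiv c ↔ ∀ d : KolyvaginHeegnerData Dt β ι c.1,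
        ∃ Q : (W.baseChange (ringClassField K ι c.1)).toAffine.Point,
          ((p ^ u : ℕ) : ℤ) • Q = d.derivedPoint) →
      (∀ c, m c = if mdiv c < Zhang2014.levelIndex W p c.1 then mdiv c else ⊤) →
      ∀ mInf : ℕ, (∀ c, (mInf : ℕ∞) ≤ m c) →
        (∀ m' : ℕ, ∃ c, (m' : ℕ∞) ≤ Zhang2014.levelIndex W p c.1 ∧ m c = mInf) →
      ∀ (k : ℕ) c, 1 ≤ k → Jetchev2008.IsGlobalCoreVertex W K ι τ p k c.1 → m c = mInf →
        (k : ℕ∞) + mInf ≤ Zhang2014.levelIndex W p c.1 →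
        padicValNat p ((W.baseChange ℚ_[q]).localTamagawaNumber ℤ_[q]) < k → mInf < k →
        padicValNat p ((W.baseChange ℚ_[q]).localTamagawaNumber ℤ_[q]) ≤ mInf)
    :
    ∀ (W : WeierstrassCurve ℚ) [W.IsElliptic] [W.IsGloballyMinimal] [NeZero (W.conductorNorm ℤ)],
      ¬ W.HasCM →
      ∀ (K : Type) [Field K] [NumberField K], IsImaginaryQuadratic K →
      NumberField.discr K ≠ -3 → NumberField.discr K ≠ -4 →
      SatisfiesHeegnerHypothesis (W.conductorNorm ℤ) K →
      ∀ (p : ℕ) [Fact p.Prime], p ≠ 2 → Addv W p → 0 ≤ padicValRat p W.j →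
      W.HasIrreducibleModPGaloisRep p →
      ¬ p ∣ (W.baseChange ℚ_[p]).localTamagawaNumber ℤ_[p] →
      (∀ (q' : ℕ) [Fact q'.Prime], q' ∣ W.conductorNorm ℤ →
        p ∣ (W.baseChange ℚ_[q']).localTamagawaNumber ℤ_[q'] → ¬ q' ^ 2 ∣ W.conductorNorm ℤ) →
      ∀ (Dt : ModularParametrizationData W (W.conductorNorm ℤ)) (β : ℤ) (ι : K →+* ℂ)
        (d₁ : KolyvaginHeegnerData Dt β ι 1), ¬ IsOfFinAddOrder d₁.derivedPoint →
      ∀ (q : ℕ) [Fact q.Prime], q ∣ W.conductorNorm ℤ → ¬ q ^ 2 ∣ W.conductorNorm ℤ → q ≠ p →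
      ∀ (s : ℕ), s ≤ padicValNat p ((W.baseChange ℚ_[q]).localTamagawaNumber ℤ_[q]) →
      ∀ (n : ℕ) (d : KolyvaginHeegnerData Dt β ι n), Squarefree n →
        (∀ ℓ ∈ n.primeFactors, Zhang2014.IsKolyvaginPrime (W.conductorNorm ℤ) W K p ℓ ∧
          s ≤ Zhang2014.kolyvaginIndex W p ℓ) →
        ∃ Q : (W.baseChange (ringClassField K ι n)).toAffine.Point,
          ((p ^ s : ℕ) : ℤ) • Q = d.derivedPoint := by
  intro W _ _ _ hcm K _ _ hK hD3 hD4 hH p _ hp2 hadd hj hirr hcp htam Dt β ι d₁ hy q _ hqN hq2 hqp s hs n d hn hℓ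
  have hpN : p ∣ W.conductorNorm ℤ := (W.dvd_conductorNorm_iff_not_hasGoodReductionAtPrime p).mpr hadd.1
  obtain ⟨τ, hτ⟩ := exists_algEquiv_ne_one_of_isImaginaryQuadratic K hK
  haveI : ∀ k : ℕ, NumberField (ringClassField K ι k) := hRCF K ι hK
  refine derivedPoint_divisible_of_levelRaising_of_section6_min W K p Dt β ι _
    (hRaiseI W hcm K hK hD3 hD4 hH τ hτ p hp2 hirr hpN Dt β ι) ?_ s hs n d hn hℓ
  intro mdiv m hchar hmdef mInf hmInf hKoly
  exact ⟨fun k c ↦ mInf < k → Jetchev2008.IsGlobalCoreVertex W K ι τ p k c.1,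
    fun k c hk hmc hMc ↦ by
      by_cases hik : mInf < k
      · obtain ⟨c', hcore, hM', hm'⟩ := exists_coreVertex_of_coreVertexExistenceIrredPlt hCVIlt W hcm K hK hD3
          hD4 hH τ hτ p hp2 hirr hpN Dt β ι d₁ hy mdiv m hchar hmdef mInf k c hk hmc hMc hik
        exact ⟨c', fun _ ↦ hcore, hM', hm'⟩
      · exact ⟨c, fun h ↦ absurd h hik, by rw [add_comm]; exact hMc, le_of_eq hmc⟩,
    fun k c hk hcore hmc hMc htk hik ↦ H63I W hcm K hK hD3 hD4 hH τ hτ p hp2 hadd hj hirr hcp htam Dt β ι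
      d₁ hy q hqN hq2 hqp mdiv m hchar hmdef mInf hmInf hKoly k c hk (hcore hik) hmc hMc htk hik⟩

/-- **On the face `p ≠ 3`: S2 (with the one extra binder `p ≠ 3`) ⟸ {`h47P2`, `hPT`, `hGZg`, S3′-lt, `hRCF`, `H63I`}** — the
schema `hRaiseI` of the previous theorem DISCHARGED by this seat's kernel walk `levelRaising_of_prop47P2_of_poitouTate_of_GZ31g`
(`p ≠ 3` makes every Zhang–Kolyvagin prime odd, the guard of `h47P2`). On the K8-t′ face (`p ≥ 5`) the extra binder is idle.
CONDITIONAL on the three named facts + S3′-lt + H63I; nothing asserted. [cite: McCallumLMS1991, §5 Prop. 5.2 and proof (pp. 304–306)]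
[cite: Jetchev2008, proof of Thm. 1.4 (p. 825)] [cite: GrossLMS1991, Prop. 3.7 (2)] [cite: GrossZagier1986, III (3.1)] -/
theorem divisibilityIrredAddv_ne_three_of_prop47P2_of_poitouTate_of_GZ31g_of_coreVertexExistenceIrredPlt_of_thm63
    (h47P2 : ∀ (W : WeierstrassCurve ℚ) [W.IsElliptic] [W.IsGloballyMinimal] [NeZero (W.conductorNorm ℤ)],
        ¬ W.HasCM →
        ∀ (K : Type) [Field K] [NumberField K], IsImaginaryQuadratic K →
        NumberField.discr K ≠ -3 → NumberField.discr K ≠ -4 →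
        SatisfiesHeegnerHypothesis (W.conductorNorm ℤ) K →
        ∀ (p : ℕ) [Fact p.Prime], p ≠ 2 → W.HasIrreducibleModPGaloisRep p → (p : ℤ) ∣ W.conductorNorm ℤ →
        ∀ (Dt : ModularParametrizationData W (W.conductorNorm ℤ)) (β : ℤ) (ι : K →+* ℂ)
          (M : ℕ), 1 ≤ M →
        ∀ (m l : ℕ), Squarefree (m * l) → l.Prime → l ≠ 2 → ¬ l ∣ m →
          (∀ l' ∈ (m * l).primeFactors, Zhang2014.IsKolyvaginPrime (W.conductorNorm ℤ) W K p l' ∧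
            M ≤ Zhang2014.kolyvaginIndex W p l') →
        ∀ (d : KolyvaginHeegnerData Dt β ι m) (d' : KolyvaginHeegnerData Dt β ι (m * l)),
          (∀ l' ∈ m.primeFactors, ∀ (x : ringClassField K ι m) (x' : ringClassField K ι (m * l)),
            (x : ℂ) = x' → ((d'.σ l' x' : ringClassField K ι (m * l)) : ℂ) = (d.σ l' x : ℂ)) →
          (∀ s ∈ d.S, ∃ s' ∈ d'.S, ∀ (x : ringClassField K ι m) (x' : ringClassField K ι (m * l)),
            (x : ℂ) = x' → ((s' x' : ringClassField K ι (m * l)) : ℂ) = (s x : ℂ)) →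
          (∀ s' ∈ d'.S, ∃ s ∈ d.S, ∀ (x : ringClassField K ι m) (x' : ringClassField K ι (m * l)),
            (x : ℂ) = x' → ((s' x' : ringClassField K ι (m * l)) : ℂ) = (s x : ℂ)) →
          (∀ (x : ringClassField K ι m) (x' : ringClassField K ι (m * l)),
            (x : ℂ) = x' → d'.emb x' = d.emb x) →
        ∀ (v : HeightOneSpectrum (𝓞 K)), (l : 𝓞 K) ∈ v.asIdeal →
        ∀ (j : ℕ),
          (((p ^ j : ℕ) : ℤ) • d'.kolyvaginClass (Fact.out : p.Prime) M ∈
              (W.baseChange K).torsionLocalKer (v.adicCompletion K) ((p ^ M : ℕ) : ℤ) ↔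
            ((p ^ j : ℕ) : ℤ) • d.kolyvaginClass (Fact.out : p.Prime) M ∈
              (W.baseChange K).torsionLocalKer (v.adicCompletion K) ((p ^ M : ℕ) : ℤ)))
    (hPT : ∀ (K : Type) [Field K] [NumberField K], poitouTate_selmerStructure_duality_conj K)
    (hGZg : ∀ (W : WeierstrassCurve ℚ) [W.IsElliptic] [W.IsGloballyMinimal] [NeZero (W.conductorNorm ℤ)]
      (K : Type) [Field K] [NumberField K], IsImaginaryQuadratic K →
      NumberField.discr K ≠ -3 → NumberField.discr K ≠ -4 →
      SatisfiesHeegnerHypothesis (W.conductorNorm ℤ) K →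
      ∀ (p : ℕ) [Fact p.Prime], p ≠ 2 → W.HasIrreducibleModPGaloisRep p →
      ∀ (Dt : ModularParametrizationData W (W.conductorNorm ℤ)) (β : ℤ) (ι : K →+* ℂ)
      [∀ j : ℕ, NumberField (ringClassField K ι j)],
      ∃ n' : ℤ, IsCoprime (p : ℤ) n' ∧ ∀ (m : ℕ), Squarefree m →
        (∀ q ∈ m.primeFactors, Zhang2014.IsKolyvaginPrime (W.conductorNorm ℤ) W K p q) →
        ∀ (dm : KolyvaginHeegnerData Dt β ι m)
        (γ : ringClassField K ι m ≃ₐ[ℚ] ringClassField K ι m), γ ∈ ringClassGal ι m →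
        ∀ v : HeightOneSpectrum (𝓞 K), ¬ (W.baseChange K).HasGoodReductionAt v →
          n' • pointsMap (W.baseChange K) (v.adicCompletion K)
              (dm.toGeomPoints (pointGalHom W (ringClassField K ι m) γ dm.y)) ∈
            E0Receptacle (W.baseChange K) v ∧
          ∀ (ℓ : ℕ), ℓ ∈ m.primeFactors → ∀ (dm' : KolyvaginHeegnerData Dt β ι (m / ℓ))
            (hle : ringClassField K ι (m / ℓ) ≤ ringClassField K ι m),
            n' • pointsMap (W.baseChange K) (v.adicCompletion K)
                (dm.toGeomPoints (pointGalHom W (ringClassField K ι m) γ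
                  (WeierstrassCurve.Affine.Point.map (W' := W)
                    ((RingClassField.inclusion ι hle).restrictScalars ℚ) dm'.y))) ∈
              E0Receptacle (W.baseChange K) v)
    (hCVIlt : ∀ (W : WeierstrassCurve ℚ) [W.IsElliptic] [W.IsGloballyMinimal] [NeZero (W.conductorNorm ℤ)],
        ¬ W.HasCM →
        ∀ (K : Type) [Field K] [NumberField K], IsImaginaryQuadratic K →
        NumberField.discr K ≠ -3 → NumberField.discr K ≠ -4 →
        SatisfiesHeegnerHypothesis (W.conductorNorm ℤ) K →
        ∀ (τ : K ≃ₐ[ℚ] K), τ ≠ 1 →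
        ∀ (p : ℕ) [Fact p.Prime], p ≠ 2 → W.HasIrreducibleModPGaloisRep p → (p : ℤ) ∣ W.conductorNorm ℤ →
        ∀ (Dt : ModularParametrizationData W (W.conductorNorm ℤ)) (β : ℤ) (ι : K →+* ℂ)
          [∀ k : ℕ, NumberField (ringClassField K ι k)]
          (d₁ : KolyvaginHeegnerData Dt β ι 1), ¬ IsOfFinAddOrder d₁.derivedPoint →
        ∀ (m : ℕ), 1 ≤ m →
        ∀ (c : ℕ) (d : KolyvaginHeegnerData Dt β ι c), Squarefree c →
          (∀ ℓ ∈ c.primeFactors, Zhang2014.IsKolyvaginPrime (W.conductorNorm ℤ) W K p ℓ) →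
        ∀ (s : ℕ), s < m → ¬ IsOfFinAddOrder d.derivedPoint →
          (∃ Q : (W.baseChange (ringClassField K ι c)).toAffine.Point,
            ((p ^ s : ℕ) : ℤ) • Q = d.derivedPoint) →
          (¬ ∃ Q : (W.baseChange (ringClassField K ι c)).toAffine.Point,
            ((p ^ (s + 1) : ℕ) : ℤ) • Q = d.derivedPoint) →
          ((s + m : ℕ) : ℕ∞) ≤ Zhang2014.levelIndex W p c →
          ∃ (c' : ℕ) (d' : KolyvaginHeegnerData Dt β ι c'), Squarefree c' ∧
            (∀ ℓ ∈ c'.primeFactors, Zhang2014.IsKolyvaginPrime (W.conductorNorm ℤ) W K p ℓ ∧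
              m + s ≤ Zhang2014.kolyvaginIndex W p ℓ) ∧
            Jetchev2008.IsGlobalCoreVertex W K ι τ p m c' ∧
            ¬ IsOfFinAddOrder d'.derivedPoint ∧
            ¬ ∃ Q : (W.baseChange (ringClassField K ι c')).toAffine.Point,
              ((p ^ (s + 1) : ℕ) : ℤ) • Q = d'.derivedPoint)
    (hRCF : ∀ (K : Type) [Field K] [NumberField K] (ι : K →+* ℂ), IsImaginaryQuadratic K →
      ∀ k : ℕ, NumberField (ringClassField K ι k))
    (H63I : ∀ (W : WeierstrassCurve ℚ) [W.IsElliptic] [W.IsGloballyMinimal] [NeZero (W.conductorNorm ℤ)],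
      ¬ W.HasCM → ∀ (K : Type) [Field K] [NumberField K], IsImaginaryQuadratic K →
      NumberField.discr K ≠ -3 → NumberField.discr K ≠ -4 →
      SatisfiesHeegnerHypothesis (W.conductorNorm ℤ) K →
      ∀ (τ : K ≃ₐ[ℚ] K), τ ≠ 1 →
      ∀ (p : ℕ) [Fact p.Prime], p ≠ 2 → Rank1Residual.Addv W p → 0 ≤ padicValRat p W.j →
      W.HasIrreducibleModPGaloisRep p →
      ¬ p ∣ (W.baseChange ℚ_[p]).localTamagawaNumber ℤ_[p] →
      (∀ (q' : ℕ) [Fact q'.Prime], q' ∣ W.conductorNorm ℤ →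
        p ∣ (W.baseChange ℚ_[q']).localTamagawaNumber ℤ_[q'] → ¬ q' ^ 2 ∣ W.conductorNorm ℤ) →
      ∀ (Dt : ModularParametrizationData W (W.conductorNorm ℤ)) (β : ℤ) (ι : K →+* ℂ)
        [∀ k : ℕ, NumberField (ringClassField K ι k)]
        (d₁ : KolyvaginHeegnerData Dt β ι 1), ¬ IsOfFinAddOrder d₁.derivedPoint →
      ∀ (q : ℕ) [Fact q.Prime], q ∣ W.conductorNorm ℤ → ¬ q ^ 2 ∣ W.conductorNorm ℤ → q ≠ p →
      ∀ (mdiv m : {c : ℕ // Squarefree c ∧ ∀ ℓ ∈ c.primeFactors,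
          Zhang2014.IsKolyvaginPrime (W.conductorNorm ℤ) W K p ℓ} → ℕ∞),
      (∀ c (u : ℕ), (u : ℕ∞) ≤ mdiv c ↔ ∀ d : KolyvaginHeegnerData Dt β ι c.1,
        ∃ Q : (W.baseChange (ringClassField K ι c.1)).toAffine.Point,
          ((p ^ u : ℕ) : ℤ) • Q = d.derivedPoint) →
      (∀ c, m c = if mdiv c < Zhang2014.levelIndex W p c.1 then mdiv c else ⊤) →
      ∀ mInf : ℕ, (∀ c, (mInf : ℕ∞) ≤ m c) →
        (∀ m' : ℕ, ∃ c, (m' : ℕ∞) ≤ Zhang2014.levelIndex W p c.1 ∧ m c = mInf) →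
      ∀ (k : ℕ) c, 1 ≤ k → Jetchev2008.IsGlobalCoreVertex W K ι τ p k c.1 → m c = mInf →
        (k : ℕ∞) + mInf ≤ Zhang2014.levelIndex W p c.1 →
        padicValNat p ((W.baseChange ℚ_[q]).localTamagawaNumber ℤ_[q]) < k → mInf < k →
        padicValNat p ((W.baseChange ℚ_[q]).localTamagawaNumber ℤ_[q]) ≤ mInf)
    :
    ∀ (W : WeierstrassCurve ℚ) [W.IsElliptic] [W.IsGloballyMinimal] [NeZero (W.conductorNorm ℤ)],
      ¬ W.HasCM →
      ∀ (K : Type) [Field K] [NumberField K], IsImaginaryQuadratic K →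
      NumberField.discr K ≠ -3 → NumberField.discr K ≠ -4 →
      SatisfiesHeegnerHypothesis (W.conductorNorm ℤ) K →
      ∀ (p : ℕ) [Fact p.Prime], p ≠ 2 → p ≠ 3 → Addv W p → 0 ≤ padicValRat p W.j →
      W.HasIrreducibleModPGaloisRep p →
      ¬ p ∣ (W.baseChange ℚ_[p]).localTamagawaNumber ℤ_[p] →
      (∀ (q' : ℕ) [Fact q'.Prime], q' ∣ W.conductorNorm ℤ →
        p ∣ (W.baseChange ℚ_[q']).localTamagawaNumber ℤ_[q'] → ¬ q' ^ 2 ∣ W.conductorNorm ℤ) →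
      ∀ (Dt : ModularParametrizationData W (W.conductorNorm ℤ)) (β : ℤ) (ι : K →+* ℂ)
        (d₁ : KolyvaginHeegnerData Dt β ι 1), ¬ IsOfFinAddOrder d₁.derivedPoint →
      ∀ (q : ℕ) [Fact q.Prime], q ∣ W.conductorNorm ℤ → ¬ q ^ 2 ∣ W.conductorNorm ℤ → q ≠ p →
      ∀ (s : ℕ), s ≤ padicValNat p ((W.baseChange ℚ_[q]).localTamagawaNumber ℤ_[q]) →
      ∀ (n : ℕ) (d : KolyvaginHeegnerData Dt β ι n), Squarefree n →
        (∀ ℓ ∈ n.primeFactors, Zhang2014.IsKolyvaginPrime (W.conductorNorm ℤ) W K p ℓ ∧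
          s ≤ Zhang2014.kolyvaginIndex W p ℓ) →
        ∃ Q : (W.baseChange (ringClassField K ι n)).toAffine.Point,
          ((p ^ s : ℕ) : ℤ) • Q = d.derivedPoint := by
  intro W _ _ _ hcm K _ _ hK hD3 hD4 hH p _ hp2 hp3 hadd hj hirr hcp htam Dt β ι d₁ hy q _ hqN hq2 hqp s hs n d hn hℓ
  have hpN : p ∣ W.conductorNorm ℤ := (W.dvd_conductorNorm_iff_not_hasGoodReductionAtPrime p).mpr hadd.1
  obtain ⟨τ, hτ⟩ := exists_algEquiv_ne_one_of_isImaginaryQuadratic K hK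
  haveI : ∀ k : ℕ, NumberField (ringClassField K ι k) := hRCF K ι hK
  refine derivedPoint_divisible_of_levelRaising_of_section6_min W K p Dt β ι _
    (levelRaising_of_prop47P2_of_poitouTate_of_GZ31g h47P2 hPT hGZg W hcm K hK hD3 hD4 hH τ hτ p hp2 hp3 hirr hpN Dt β ι)
    ?_ s hs n d hn hℓ
  intro mdiv m hchar hmdef mInf hmInf hKoly
  exact ⟨fun k c ↦ mInf < k → Jetchev2008.IsGlobalCoreVertex W K ι τ p k c.1,
    fun k c hk hmc hMc ↦ by
      by_cases hik : mInf < k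
      · obtain ⟨c', hcore, hM', hm'⟩ := exists_coreVertex_of_coreVertexExistenceIrredPlt hCVIlt W hcm K hK hD3
          hD4 hH τ hτ p hp2 hirr hpN Dt β ι d₁ hy mdiv m hchar hmdef mInf k c hk hmc hMc hik
        exact ⟨c', fun _ ↦ hcore, hM', hm'⟩
      · exact ⟨c, fun h ↦ absurd h hik, by rw [add_comm]; exact hMc, le_of_eq hmc⟩,
    fun k c hk hcore hmc hMc htk hik ↦ H63I W hcm K hK hD3 hD4 hH τ hτ p hp2 hadd hj hirr hcp htam Dt β ι
      d₁ hy q hqN hq2 hqp mdiv m hchar hmdef mInf hmInf hKoly k c hk (hcore hik) hmc hMc htk hik⟩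

end Summit.BirchSwinnertonDyer.BirchSwinnertonDyer.Theorems.JetchevIrreducibleSwap

end
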